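import Literature.NumberTheory.LFunctions.VinogradovMeanValueCount
import Mathlib.Analysis.SpecialFunctions.Pow.Real
import HarnessLib

/-!
# Vinogradov's mean value theorem as a parametrised hypothesis (the shape of Ivić's Lemma 6.3)

Topic `Literature/NumberTheory/LFunctions`.  This file introduces ONE definition — a parametrised
hypothesis `VMVTBound A` (a predicate in the constant `A`, in the same spirit as `ExpSumBound C D`,
`RichertTypeBound A B P`, `VinogradovRangeBound K C c` of the tree), NOT a named fact — and proves two
trivial API lemmas.  It is the interface between the two halves of the proof of the Vinogradov–Korobov
estimate for the zeta sums (A. Ivić, *The Riemann Zeta-Function*, Wiley 1985, Theorem 6.2):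

* the arithmetic half, Vinogradov's mean value theorem in the explicit form of Ivić's **Lemma 6.3**
  (p. 119): for integers `n ≥ 2`, `r ≥ 0`, `k ≥ n² + nr` and `P` large,
  `J_{k,n}(P) ≤ (4n)^{4kr} P^{2k − (n²+n)/2 + c_r}`, `c_r = ½(n²+n)(1 − 1/n)^r`, where `J_{k,n}(P)`
  (`VMV.J n k [1, P]`, `VinogradovMeanValueCount.lean`) is the number of solutions of Vinogradov's system —
  being proved bottom-up in the tree (`VinogradovMeanValueStepA.lean`, …);
* the analytic half, Theorem 6.2 from Lemma 6.3 (`VinogradovZetaSumShift.lean`, `VinogradovZetaSumCore.lean`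
  and their sequel), which consumes the mean value theorem ONLY through `VMVTBound A` for some `A`.

`VMVTBound A` asks for Lemma 6.3 with `4` replaced by an arbitrary constant `A`, both in the factor
`(An)^{Akr}` and in the largeness condition on `P`, which we take in the form of Ivić's (6.28),
`P ≥ (An)^{An(1 + 1/(n−1))^r}` (Lemma 6.3 as printed has no such restriction — its proof treats small `P`
separately through (6.30)–(6.32) — so it gives `VMVTBound 4` a fortiori, `vmvtBound_of_forall`).  Any
larger `A` is weaker (`VMVTBound.mono` is not needed downstream and not stated); the consumer proves
`∀ A ≥ 1, VMVTBound A → ∃ C c > 0, VinogradovRangeBound 10 C c`.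

## References
* A. Ivić, *The Riemann Zeta-Function*, John Wiley & Sons 1985 (Dover 2003), §6.2, Lemma 6.3 and (6.28).
  [cite: Ivic1985, Lemma 6.3]
-/

noncomputable section

open Finset Real

namespace Literature.NumberTheory.LFunctions

/-- **Vinogradov's mean value theorem in the shape of Ivić's Lemma 6.3, with constant `A`**: for all
integers `n ≥ 2`, `ρ ≥ 0`, `k ≥ n² + nρ` and `P` with `P ≥ (An)^{An(1 + 1/(n−1))^ρ}`,
`J_{k,n}([1, P]) ≤ (An)^{Akρ} · P^{2k − ½(n² + n)(1 − (1 − 1/n)^ρ)}`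
(Ivić: `A = 4`, exponent written `2k − ½(n²+n) + c_ρ`, `c_ρ = ½(n²+n)(1−1/n)^ρ`).  A predicate in `A`
(the hypothesis of `vinogradovRangeBound_of_vmvt`), not a named fact. [cite: Ivic1985, Lemma 6.3] -/
def VMVTBound (A : ℝ) : Prop :=
  ∀ (n ρ k P : ℕ), 2 ≤ n → n ^ 2 + n * ρ ≤ k →
    (A * n) ^ (A * n * (1 + 1 / ((n : ℝ) - 1)) ^ ρ) ≤ (P : ℝ) →
      (VMV.J n k (Finset.Icc (1 : ℤ) P) : ℝ) ≤
        (A * n) ^ (A * k * ρ) * (P : ℝ) ^ (2 * (k : ℝ) - ((n : ℝ) ^ 2 + n) / 2 * (1 - (1 - 1 / (n : ℝ)) ^ ρ))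

/-- Unfolding lemma. [folklore] -/
theorem vmvtBound_iff (A : ℝ) : VMVTBound A ↔
    ∀ (n ρ k P : ℕ), 2 ≤ n → n ^ 2 + n * ρ ≤ k →
      (A * n) ^ (A * n * (1 + 1 / ((n : ℝ) - 1)) ^ ρ) ≤ (P : ℝ) →
        (VMV.J n k (Finset.Icc (1 : ℤ) P) : ℝ) ≤
          (A * n) ^ (A * k * ρ) * (P : ℝ) ^ (2 * (k : ℝ) - ((n : ℝ) ^ 2 + n) / 2 * (1 - (1 - 1 / (n : ℝ)) ^ ρ)) :=
  Iff.rfl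

/-- Lemma 6.3 without a largeness condition on `P` (as printed by Ivić, for any constant `A` in place of
`4`) gives `VMVTBound A`. [cite: Ivic1985, Lemma 6.3] -/
theorem vmvtBound_of_forall {A : ℝ}
    (h : ∀ (n ρ k P : ℕ), 2 ≤ n → n ^ 2 + n * ρ ≤ k → 1 ≤ P →
      (VMV.J n k (Finset.Icc (1 : ℤ) P) : ℝ) ≤
        (A * n) ^ (A * k * ρ) * (P : ℝ) ^ (2 * (k : ℝ) - ((n : ℝ) ^ 2 + n) / 2 * (1 - (1 - 1 / (n : ℝ)) ^ ρ)))
    (hA : 1 ≤ A) : VMVTBound A := by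
  intro n ρ k P hn hk hP
  refine h n ρ k P hn hk ?_
  -- `(An)^{…} ≥ 1` since `An ≥ 2`
  have hbase : (1 : ℝ) ≤ A * n := by
    have : (2 : ℝ) ≤ n := by exact_mod_cast hn
    nlinarith
  have h1 : (1 : ℝ) ≤ (A * n) ^ (A * n * (1 + 1 / ((n : ℝ) - 1)) ^ ρ) := Real.one_le_rpow hbase (by
    have : (2 : ℝ) ≤ n := by exact_mod_cast hn
    have h2 : 0 ≤ 1 + 1 / ((n : ℝ) - 1) := by
      have : 0 < (n : ℝ) - 1 := by linarith
      positivity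
    positivity)
  exact_mod_cast h1.trans hP

end Literature.NumberTheory.LFunctions
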